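import Literature.Geometry.Kaehler.DDcPowComplexFrame
import Literature.Geometry.Kaehler.TwoPowPairFrame
import Literature.Geometry.Kaehler.KaehlerFormPower
import Mathlib.Analysis.InnerProductSpace.Calculus
import Mathlib.Analysis.InnerProductSpace.PiL2
import HarnessLib

/-!
# `(dd^c F(‖z‖²))ᵖ` on the complex frame of a complex `p`-plane

For a radial weight `w(z) = F(‖z‖²)` (`F : ℝ → ℝ` of class `C²`) on a complex inner product space
`V`, the Hessian is `D²w(z)(a, b) = 4F''(‖z‖²) Re⟨z,a⟩ Re⟨z,b⟩ + 2F'(‖z‖²) Re⟨a,b⟩`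
(`fderiv_fderiv_comp_norm_sq_apply`), so that
`(dd^c w)(z)(a, b) = 4F'' (Re⟨z,a⟩ Im⟨z,b⟩ - Im⟨z,a⟩ Re⟨z,b⟩) + 4F' Im⟨a,b⟩`
(`ddcForm_comp_norm_sq_apply`). On the complex frame `(u₀, i u₀, …, u_{p-1}, i u_{p-1})` of a
unitary `p`-frame `u` (`p ≥ 1`) this gives the **radial Monge–Ampère density**

`(dd^c w)(z)ᵖ(u₀, i u₀, …) = p! 4ᵖ F'(‖z‖²)^{p-1} (F'(‖z‖²) + F''(‖z‖²) Σⱼ |⟨uⱼ, z⟩|²)`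

(`twoPow_ddcForm_comp_norm_sq_complexFrame`), where `Σⱼ |⟨uⱼ, z⟩|² = ‖pr_K z‖² ≤ ‖z‖²` is the
squared norm of the orthogonal projection of `z` to the complex plane `K = span u`: for a frame
adapted to `pr_K z` (all but one `uⱼ` orthogonal to `z`) the pair relations of
`twoPow_apply_complexPairFrame` hold with `cⱼ = 4(F' + F''|⟨uⱼ, z⟩|²)`
(`twoPow_ddcForm_comp_norm_sq_complexFrame_of_adapted`); adapted unitary frames of `K` exist
(`exists_orthonormal_adapted`), and the value of a `2p`-covector on the complex frame does not
depend on the unitary frame of `K` (`apply_complexFrame_eq_of_orthonormal`). This is the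
pointwise identity behind `∫_{A_r} (dd^c g(log|z|))ᵖ` in the computation of Lelong numbers
[Chirka1989, §15.1]; [Demailly, *Complex analytic and differential geometry*, Ch. III (5.5)–(5.6)].
Also recorded: `Σ_k Re⟨ξ_k, z⟩² = Σⱼ |⟨uⱼ, z⟩|²` over the slots of the complex frame `ξ`
(`sum_sq_re_inner_complexFrame`), the measurable expression of the tangential fraction.

Theorems only.

## References

* E. M. Chirka, *Complex Analytic Sets*, Kluwer 1989, §13.2, §15.1 [Chirka1989].
* J.-P. Demailly, *Complex analytic and differential geometry*, Ch. III §5.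
-/

noncomputable section

open scoped InnerProductSpace ComplexConjugate Topology
open Set Filter Complex Module

namespace Literature.Geometry.Kaehler

open TwoForm

variable {V : Type*} [NormedAddCommGroup V] [InnerProductSpace ℂ V]

/-! ### The Hessian of a radial weight -/

section Hessian

variable {F : ℝ → ℝ}

/-- Smoothness of the radial weight `z ↦ F(‖z‖²)`. [folklore] -/
theorem contDiff_comp_norm_sq {n : WithTop ℕ∞} (hF : ContDiff ℝ n F) :
    ContDiff ℝ n fun z : V => F (‖z‖ ^ 2) :=
  hF.comp (contDiff_norm_sq ℂ)

/-- **The Hessian of a radial weight, real inner product spaces**: for `F` of class `C²`,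
`D²(F ∘ ‖·‖²)(z)(a)(b) = 4F''(‖z‖²) ⟨z,a⟩ ⟨z,b⟩ + 2F'(‖z‖²) ⟨a,b⟩`. [folklore] -/
theorem fderiv_fderiv_comp_norm_sq_apply_real {E : Type*} [NormedAddCommGroup E]
    [InnerProductSpace ℝ E] (hF : ContDiff ℝ 2 F) (z a b : E) :
    fderiv ℝ (fderiv ℝ (fun y : E => F (‖y‖ ^ 2))) z a b =
      4 * deriv (deriv F) (‖z‖ ^ 2) * ⟪z, a⟫_ℝ * ⟪z, b⟫_ℝ + 2 * deriv F (‖z‖ ^ 2) * ⟪a, b⟫_ℝ := by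
  have hF1 : Differentiable ℝ F := hF.differentiable (by norm_num)
  have hF' : ContDiff ℝ 1 (deriv F) := by
    have h := hF
    rw [show (2 : WithTop ℕ∞) = 1 + 1 from rfl, contDiff_succ_iff_deriv] at h
    exact h.2.2
  have hdF : ∀ t, HasDerivAt F (deriv F t) t := fun t => (hF1 t).hasDerivAt
  have hdF' : ∀ t, HasDerivAt (deriv F) (deriv (deriv F) t) t := fun t =>
    ((hF'.differentiable one_ne_zero) t).hasDerivAt
  -- the derivative of `‖·‖²`, with a real scalar factor
  have hns : ∀ y : E, HasFDerivAt (fun x : E => ‖x‖ ^ 2) ((2 : ℝ) • innerSL ℝ y) y := fun y => by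
    have h := (hasStrictFDerivAt_norm_sq y).hasFDerivAt
    rwa [← Nat.cast_smul_eq_nsmul ℝ, Nat.cast_ofNat] at h
  -- first derivative, everywhere
  have h1 : ∀ y : E, HasFDerivAt (fun y : E => F (‖y‖ ^ 2))
      (deriv F (‖y‖ ^ 2) • ((2 : ℝ) • innerSL ℝ y)) y := fun y => by
    have e := (hdF (‖y‖ ^ 2)).comp_hasFDerivAt y (hns y)
    exact e
  have hfd : fderiv ℝ (fun y : E => F (‖y‖ ^ 2)) =
      fun y => deriv F (‖y‖ ^ 2) • ((2 : ℝ) • innerSL ℝ y) := funext fun y => (h1 y).fderiv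
  -- second derivative at `z`
  have hc : HasFDerivAt (fun y : E => deriv F (‖y‖ ^ 2))
      (deriv (deriv F) (‖z‖ ^ 2) • ((2 : ℝ) • innerSL ℝ z)) z := by
    have e := (hdF' (‖z‖ ^ 2)).comp_hasFDerivAt z (hns z)
    exact e
  have hM : HasFDerivAt (fun y : E => (2 : ℝ) • innerSL ℝ y)
      ((2 : ℝ) • (innerSL ℝ : E →L[ℝ] E →L[ℝ] ℝ)) z :=
    ((innerSL ℝ : E →L[ℝ] E →L[ℝ] ℝ).hasFDerivAt).const_smul (2 : ℝ)
  have h2 : HasFDerivAt (fun y : E => deriv F (‖y‖ ^ 2) • ((2 : ℝ) • innerSL ℝ y))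
      (deriv F (‖z‖ ^ 2) • ((2 : ℝ) • (innerSL ℝ : E →L[ℝ] E →L[ℝ] ℝ)) +
        (deriv (deriv F) (‖z‖ ^ 2) • ((2 : ℝ) • innerSL ℝ z)).smulRight ((2 : ℝ) • innerSL ℝ z)) z :=
    hc.smul hM
  rw [hfd, h2.fderiv]
  have e : ((innerSL ℝ : E →L[ℝ] E →L[ℝ] ℝ) a) b = ⟪a, b⟫_ℝ := rfl
  simp [smul_eq_mul, e]
  ring

/-- **The Hessian of a radial weight** on a complex inner product space: for `F` of class `C²`,
`D²(F ∘ ‖·‖²)(z)(a)(b) = 4F''(‖z‖²) Re⟨z,a⟩ Re⟨z,b⟩ + 2F'(‖z‖²) Re⟨a,b⟩`. [folklore] -/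
theorem fderiv_fderiv_comp_norm_sq_apply (hF : ContDiff ℝ 2 F) (z a b : V) :
    fderiv ℝ (fderiv ℝ (fun y : V => F (‖y‖ ^ 2))) z a b =
      4 * deriv (deriv F) (‖z‖ ^ 2) * (⟪z, a⟫_ℂ).re * (⟪z, b⟫_ℂ).re +
        2 * deriv F (‖z‖ ^ 2) * (⟪a, b⟫_ℂ).re := by
  letI : InnerProductSpace ℝ V := InnerProductSpace.complexToReal
  have h := fderiv_fderiv_comp_norm_sq_apply_real hF z a b
  simp only [real_inner_eq_re_inner] at h
  exact h

/-- The Hessian of a radial weight is symmetric. [folklore] -/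
theorem fderiv_fderiv_comp_norm_sq_symm (hF : ContDiff ℝ 2 F) (z a b : V) :
    fderiv ℝ (fderiv ℝ (fun y : V => F (‖y‖ ^ 2))) z a b =
      fderiv ℝ (fderiv ℝ (fun y : V => F (‖y‖ ^ 2))) z b a := by
  rw [fderiv_fderiv_comp_norm_sq_apply hF, fderiv_fderiv_comp_norm_sq_apply hF,
    ← inner_conj_symm a b, conj_re]
  ring

/-- The differential of a `C²` radial weight is differentiable. [folklore] -/
theorem differentiableAt_fderiv_comp_norm_sq (hF : ContDiff ℝ 2 F) (z : V) :
    DifferentiableAt ℝ (fderiv ℝ (fun y : V => F (‖y‖ ^ 2))) z :=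
  (((contDiff_comp_norm_sq hF).fderiv_right (m := 1) le_rfl).differentiable one_ne_zero) z

/-- **`dd^c` of a radial weight**:
`(dd^c F(‖·‖²))(z)(a, b) = 4F'' (Re⟨z,a⟩ Im⟨z,b⟩ - Im⟨z,a⟩ Re⟨z,b⟩) + 4F' Im⟨a,b⟩`.
[cite: Chirka1989, §13.2] -/
theorem ddcForm_comp_norm_sq_apply (hF : ContDiff ℝ 2 F) (z a b : V) :
    ddcForm (fun y : V => F (‖y‖ ^ 2)) z ![a, b] =
      4 * deriv (deriv F) (‖z‖ ^ 2) * ((⟪z, a⟫_ℂ).re * (⟪z, b⟫_ℂ).im - (⟪z, a⟫_ℂ).im * (⟪z, b⟫_ℂ).re) +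
        4 * deriv F (‖z‖ ^ 2) * (⟪a, b⟫_ℂ).im := by
  rw [ddcForm_apply (differentiableAt_fderiv_comp_norm_sq hF z)]
  simp only [Matrix.cons_val_one, Matrix.cons_val_zero, fderiv_fderiv_comp_norm_sq_apply hF,
    inner_smul_right, I_re, I_im, mul_re, zero_mul, one_mul, zero_sub]
  rw [← inner_conj_symm a b, conj_im]
  ring

end Hessian

/-! ### `(dd^c F(‖·‖²))ᵖ` on adapted unitary frames -/

section Frame

variable {F : ℝ → ℝ} {p : ℕ}

/-- **`(dd^c F(‖·‖²))ᵖ` on an ADAPTED unitary frame.** If `u` is a unitary `p`-frame all of whose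
vectors but `u_{i₀}` are orthogonal to `z`, then
`(dd^c F(‖·‖²))(z)ᵖ(u₀, i u₀, …) = p! 4ᵖ F'^{p-1} (F' + F'' Σⱼ |⟨z, uⱼ⟩|²)` (derivatives at `‖z‖²`;
the pair relations of `twoPow_apply_complexPairFrame` hold with `cⱼ = 4(F' + F''|⟨z,uⱼ⟩|²)`).
[cite: Chirka1989, §15.1] -/
theorem twoPow_ddcForm_comp_norm_sq_complexFrame_of_adapted (hF : ContDiff ℝ 2 F) (z : V)
    {u : Fin p → V} (hu : Orthonormal ℂ u) {i₀ : Fin p} (had : ∀ i, i ≠ i₀ → ⟪z, u i⟫_ℂ = 0) :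
    (ddcForm (fun y : V => F (‖y‖ ^ 2)) z).twoPow p (complexFrame u) =
      p.factorial * 4 ^ p * deriv F (‖z‖ ^ 2) ^ (p - 1) *
        (deriv F (‖z‖ ^ 2) + deriv (deriv F) (‖z‖ ^ 2) * ∑ i, ‖⟪z, u i⟫_ℂ‖ ^ 2) := by
  classical
  set A := ddcForm (fun y : V => F (‖y‖ ^ 2)) z with hA
  set t := ‖z‖ ^ 2 with ht
  set ue : ℕ → V := fun i => if h : i < p then u ⟨i, h⟩ else 0 with hue
  set c : ℕ → ℝ := fun i =>
    if h : i < p then 4 * (deriv F t + deriv (deriv F) t * ‖⟪z, u ⟨i, h⟩⟫_ℂ‖ ^ 2) else 0 with hc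
  have hu' := orthonormal_iff_ite.1 hu
  have hsym := fderiv_fderiv_comp_norm_sq_symm (V := V) hF z
  have hdiff := differentiableAt_fderiv_comp_norm_sq (V := V) hF z
  -- in an adapted frame, products of coefficients of distinct vectors vanish
  have hcross : ∀ i j : Fin p, i ≠ j →
      (⟪z, u i⟫_ℂ).re * (⟪z, u j⟫_ℂ).im - (⟪z, u i⟫_ℂ).im * (⟪z, u j⟫_ℂ).re = 0 ∧
      (⟪z, u i⟫_ℂ).re * (⟪z, u j⟫_ℂ).re + (⟪z, u i⟫_ℂ).im * (⟪z, u j⟫_ℂ).im = 0 := by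
    intro i j hij
    by_cases hi : i = i₀
    · have hj : j ≠ i₀ := fun h => hij (hi.trans h.symm)
      simp [had j hj]
    · simp [had i hi]
  -- the three pair relations
  have huu : ∀ i j, i < p → j < p → A ![ue i, ue j] = 0 := by
    intro i j hi hj
    simp only [hue, dif_pos hi, dif_pos hj, hA, ddcForm_comp_norm_sq_apply hF, hu']
    by_cases hij : (⟨i, hi⟩ : Fin p) = ⟨j, hj⟩
    · rw [hij, if_pos rfl, one_im]; ring
    · rw [(hcross _ _ hij).1, if_neg hij, zero_im]; ring
  have hJJ : ∀ i j, i < p → j < p → A ![I • ue i, I • ue j] = 0 := by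
    intro i j hi hj
    rw [hA, ddcForm_apply_I_smul_I_smul hdiff hsym, ← hA, huu i j hi hj]
  have huJ : ∀ i j, i < p → j < p → A ![ue i, I • ue j] = if i = j then c i else 0 := by
    intro i j hi hj
    simp only [hue, dif_pos hi, dif_pos hj, hA, ddcForm_comp_norm_sq_apply hF, hu', inner_smul_right,
      I_re, I_im, mul_re, mul_im, zero_mul, one_mul, zero_sub, zero_add]
    by_cases hij : i = j
    · subst hij
      simp only [if_true, hc, dif_pos hi, one_re, Complex.sq_norm, Complex.normSq_apply]
      ring
    · have hij' : (⟨i, hi⟩ : Fin p) ≠ ⟨j, hj⟩ := fun h => hij (Fin.mk.inj_iff.1 h)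
      rw [if_neg hij, if_neg hij']
      have h2 := (hcross _ _ hij').2
      have e : (⟪z, u ⟨i, hi⟩⟫_ℂ).re * (⟪z, u ⟨j, hj⟩⟫_ℂ).re -
          (⟪z, u ⟨i, hi⟩⟫_ℂ).im * -(⟪z, u ⟨j, hj⟩⟫_ℂ).im = 0 := by linarith
      rw [e, zero_re]; ring
  have key := twoPow_apply_complexPairFrame A p ue c huu hJJ huJ
  rw [complexFrame_eq_interleave u, key]
  -- evaluate the product of the `cᵢ`
  have hci : ∀ i : Fin p, c i = 4 * (deriv F t + deriv (deriv F) t * ‖⟪z, u i⟫_ℂ‖ ^ 2) := by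
    intro i; simp only [hc, dif_pos i.2]
  simp only [hci]
  rw [Finset.prod_eq_mul_prod_sdiff_singleton_of_mem (Finset.mem_univ i₀), Finset.sum_eq_single i₀
    (fun i _ hi => by rw [had i hi]; simp) (fun h => absurd (Finset.mem_univ i₀) h)]
  have hrest : ∏ i ∈ Finset.univ \ {i₀}, 4 * (deriv F t + deriv (deriv F) t * ‖⟪z, u i⟫_ℂ‖ ^ 2) =
      (4 * deriv F t) ^ (p - 1) := by
    rw [Finset.prod_congr rfl (fun i hi => by
      rw [had i (Finset.mem_sdiff.1 hi |>.2 |> fun h => by simpa using h)]),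
      Finset.prod_const, Finset.card_univ_sdiff]
    simp
  rw [hrest]
  rcases Nat.exists_eq_add_of_le' (Fin.pos i₀) with ⟨q, hq⟩
  subst hq
  simp only [Nat.add_sub_cancel]
  ring

end Frame

/-! ### Adapted unitary frames and the general formula -/

section Adapted

variable {F : ℝ → ℝ} {p : ℕ}

/-- **Parseval through a subspace**: for an orthonormal basis `b` of a subspace `K` with orthogonal
projection, `Σᵢ |⟨z, bᵢ⟩|² = ‖pr_K z‖²`. [folklore] -/
theorem sum_norm_sq_inner_coe_orthonormalBasis {ι : Type*} [Fintype ι] (K : Submodule ℂ V)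
    [K.HasOrthogonalProjection] (b : OrthonormalBasis ι ℂ K) (z : V) :
    ∑ i, ‖⟪z, (b i : V)⟫_ℂ‖ ^ 2 = ‖K.orthogonalProjectionOnto z‖ ^ 2 := by
  rw [← b.sum_sq_norm_inner_right (K.orthogonalProjectionOnto z)]
  refine Finset.sum_congr rfl fun i _ => ?_
  rw [norm_inner_symm, Submodule.inner_orthogonalProjectionOnto_eq_of_mem_left]

/-- An orthonormal basis of `span u` from a unitary frame `u`. [folklore] -/
theorem exists_orthonormalBasis_span_coe_eq {u : Fin p → V} (hu : Orthonormal ℂ u) :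
    ∃ b : OrthonormalBasis (Fin p) ℂ (Submodule.span ℂ (range u)), ∀ i, (b i : V) = u i := by
  set K := Submodule.span ℂ (range u) with hK
  set v : Fin p → K := fun i => ⟨u i, Submodule.subset_span (mem_range_self i)⟩ with hv
  have hvon : Orthonormal ℂ v := by
    rw [← K.subtypeₗᵢ.orthonormal_comp_iff]
    exact hu
  have hsp : ⊤ ≤ Submodule.span ℂ (range v) := by
    rintro ⟨x, hx⟩ -
    have hx' := hx
    rw [hK] at hx'
    refine Submodule.span_induction (p := fun y hy => (⟨y, hK ▸ hy⟩ : K) ∈ Submodule.span ℂ (range v))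
      ?_ ?_ ?_ ?_ hx'
    · rintro y ⟨i, rfl⟩
      exact Submodule.subset_span ⟨i, rfl⟩
    · exact (Submodule.span ℂ (range v)).zero_mem
    · intro y w hy hw hy' hw'
      exact (Submodule.span ℂ (range v)).add_mem hy' hw'
    · intro c y hy hy'
      exact (Submodule.span ℂ (range v)).smul_mem c hy'
  exact ⟨OrthonormalBasis.mk hvon hsp, fun i => by simp [hv]⟩

/-- **Adapted unitary frames exist**: every complex `p`-plane spanned by a unitary frame `u`
(`p ≥ 1`) has, for a given `z`, a unitary frame `u'` with the same span all of whose vectors but one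
are orthogonal to `z` (extend the direction of `pr_K z` to a unitary basis), and
`Σ |⟨z, u'ᵢ⟩|² = Σ |⟨z, uᵢ⟩|² (= ‖pr_K z‖²)`. [folklore] -/
theorem exists_orthonormal_adapted {u : Fin p → V} (hu : Orthonormal ℂ u) (hp : 0 < p) (z : V) :
    ∃ (u' : Fin p → V) (i₀ : Fin p), Orthonormal ℂ u' ∧
      (∀ j, u' j ∈ Submodule.span ℂ (range u)) ∧ (∀ i, i ≠ i₀ → ⟪z, u' i⟫_ℂ = 0) ∧
      ∑ i, ‖⟪z, u' i⟫_ℂ‖ ^ 2 = ∑ i, ‖⟪z, u i⟫_ℂ‖ ^ 2 := by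
  set K := Submodule.span ℂ (range u) with hK
  haveI : FiniteDimensional ℂ K := FiniteDimensional.span_of_finite ℂ (finite_range u)
  obtain ⟨b₀, hb₀⟩ := exists_orthonormalBasis_span_coe_eq hu
  have hsum₀ : ∑ i, ‖⟪z, u i⟫_ℂ‖ ^ 2 = ‖K.orthogonalProjectionOnto z‖ ^ 2 := by
    rw [← sum_norm_sq_inner_coe_orthonormalBasis K b₀ z]
    simp_rw [hb₀]
  set ζ : K := K.orthogonalProjectionOnto z with hζ
  have hinner : ∀ w : K, ⟪z, (w : V)⟫_ℂ = ⟪ζ, w⟫_ℂ := fun w => by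
    rw [← inner_conj_symm, ← Submodule.inner_orthogonalProjectionOnto_eq_of_mem_left, inner_conj_symm]
  by_cases h0 : ζ = 0
  · -- `z ⊥ K`: the frame `u` itself is adapted
    refine ⟨u, ⟨0, hp⟩, hu, fun j => Submodule.subset_span (mem_range_self j), fun i _ => ?_, rfl⟩
    rw [← hb₀ i, hinner, h0, inner_zero_left]
  · -- extend the direction of `ζ` to a unitary basis of `K`
    set w₀ : K := ((‖ζ‖⁻¹ : ℝ) : ℂ) • ζ with hw₀
    have hζn : ‖ζ‖ ≠ 0 := norm_ne_zero_iff.2 h0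
    have hw₀n : ‖w₀‖ = 1 := by
      rw [hw₀, norm_smul, Complex.norm_real, Real.norm_of_nonneg (inv_nonneg.2 (norm_nonneg _)),
        inv_mul_cancel₀ hζn]
    have hcard : finrank ℂ K = Fintype.card (Fin p) := by
      rw [hK, finrank_span_eq_card hu.linearIndependent]
    set i₀ : Fin p := ⟨0, hp⟩
    have hvon : Orthonormal ℂ (({i₀} : Set (Fin p)).restrict fun _ : Fin p => w₀) := by
      rw [orthonormal_iff_ite]
      rintro ⟨i, hi⟩ ⟨j, hj⟩
      have hij : (⟨i, hi⟩ : ({i₀} : Set (Fin p))) = ⟨j, hj⟩ := Subsingleton.elim _ _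
      simp only [hij, if_true, Set.restrict_apply, inner_self_eq_norm_sq_to_K, hw₀n]
      norm_num
    obtain ⟨b, hb⟩ := hvon.exists_orthonormalBasis_extension_of_card_eq hcard
    have hbi₀ : b i₀ = w₀ := hb i₀ rfl
    refine ⟨fun i => (b i : V), i₀, ?_, fun j => (b j).2, fun i hi => ?_, ?_⟩
    · exact b.orthonormal.comp_linearIsometry K.subtypeₗᵢ
    · rw [hinner]
      have hζw : ζ = ((‖ζ‖ : ℝ) : ℂ) • w₀ := by
        rw [hw₀, smul_smul, ← Complex.ofReal_mul, mul_inv_cancel₀ hζn, Complex.ofReal_one, one_smul]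
      rw [hζw, inner_smul_left, ← hbi₀]
      simp [orthonormal_iff_ite.1 b.orthonormal, Ne.symm hi]
    · rw [hsum₀, sum_norm_sq_inner_coe_orthonormalBasis K b z]

/-- **The radial Monge–Ampère density.** For `F` of class `C²`, `p ≥ 1`, `z ∈ V` and ANY unitary
`p`-frame `u`,
`(dd^c F(‖·‖²))(z)ᵖ(u₀, i u₀, …, u_{p-1}, i u_{p-1}) = p! 4ᵖ F'(‖z‖²)^{p-1} (F'(‖z‖²) + F''(‖z‖²) Σⱼ |⟨z, uⱼ⟩|²)`,
where `Σⱼ |⟨z, uⱼ⟩|² = ‖pr_{span u} z‖² ≤ ‖z‖²`. For `F(t) = t` this is `p! 4ᵖ` (the Kähler case),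
for `F = g ∘ ½log` it is the density `p! 2ᵖ |z|^{-2p} (g'ᵖ (1-σ) + ½ g'^{p-1} g'' σ)`,
`σ = ‖pr z‖²/‖z‖²`, of the theory of Lelong numbers. [cite: Chirka1989, §15.1] -/
theorem twoPow_ddcForm_comp_norm_sq_complexFrame (hF : ContDiff ℝ 2 F) (hp : 0 < p) (z : V)
    {u : Fin p → V} (hu : Orthonormal ℂ u) :
    (ddcForm (fun y : V => F (‖y‖ ^ 2)) z).twoPow p (complexFrame u) =
      p.factorial * 4 ^ p * deriv F (‖z‖ ^ 2) ^ (p - 1) *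
        (deriv F (‖z‖ ^ 2) + deriv (deriv F) (‖z‖ ^ 2) * ∑ i, ‖⟪z, u i⟫_ℂ‖ ^ 2) := by
  obtain ⟨u', i₀, hu', hmem, had, hsum⟩ := exists_orthonormal_adapted hu hp z
  rw [← apply_complexFrame_eq_of_orthonormal _ hu hu' hmem,
    twoPow_ddcForm_comp_norm_sq_complexFrame_of_adapted hF z hu' had, hsum]

/-- Bessel: the tangential part is at most `‖z‖²`. [folklore] -/
theorem sum_norm_sq_inner_le {u : Fin p → V} (hu : Orthonormal ℂ u) (z : V) :
    ∑ i, ‖⟪z, u i⟫_ℂ‖ ^ 2 ≤ ‖z‖ ^ 2 := by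
  have h := hu.sum_inner_products_le z (s := Finset.univ)
  simp_rw [norm_inner_symm] at h
  exact h

/-- **The tangential fraction through the slots of the complex frame**:
`Σ_k Re⟨ξ_k, z⟩² = Σⱼ |⟨z, uⱼ⟩|²` for `ξ = (u₀, i u₀, …)` (`Re⟨i uⱼ, z⟩ = Im⟨uⱼ, z⟩`). This expresses
`‖pr z‖²` measurably through a measurable frame field. [folklore] -/
theorem sum_sq_re_inner_complexFrame (u : Fin p → V) (z : V) :
    ∑ k, (⟪complexFrame u k, z⟫_ℂ).re ^ 2 = ∑ i, ‖⟪z, u i⟫_ℂ‖ ^ 2 := by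
  rw [sum_fin_two_mul]
  refine Finset.sum_congr rfl fun j _ => ?_
  rw [complexFrame_apply_even, complexFrame_apply_odd, inner_smul_left, norm_inner_symm,
    Complex.sq_norm, Complex.normSq_apply]
  simp only [Complex.conj_I, neg_mul, neg_re, mul_re, I_re, zero_mul, I_im, one_mul, zero_sub,
    neg_neg]
  ring

end Adapted

end Literature.Geometry.Kaehler

end
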